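import Literature.Analysis.FluidPDE.Onsager
import Literature.Analysis.FluidPDE.OnsagerBDSV
import Literature.Analysis.FunctionSpaces.TorusHolderBridge
import HarnessLib

/-!
# Onsager flexibility from the BDSV scheme: the assembly "Prop. 2.1 ⇒ Thm. 1.1" (§2.2)

Buckmaster–De Lellis–Székelyhidi–Vicol (BDSV), *Onsager's conjecture for admissible weak
solutions*, CPAM 72 (2019) = arXiv:1701.08678, prove Onsager flexibility (their Thm. 1.1; the
tree's named fact `Literature.Analysis.FluidPDE.onsager_flexibility`, file `Onsager.lean`) by
reducing it in §2.2 to the **main iterative proposition** Prop. 2.1 on smooth Euler–Reynolds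
triples, plus a short **time-regularity** argument. Both ingredients are named facts of the tree
(`BDSV.mainIteration`, `BDSV.timeRegularity`, file `OnsagerBDSV.lean`, whose module docstring
refers to the present assembly). This file PROVES the reduction of §2.2:

* `onsager_flexibility_of_bdsv : BDSV.mainIteration → BDSV.timeRegularity → onsager_flexibility`
  (and the dissipative corollary `onsager_flexibility_strictAntiOn_of_bdsv`).

Hence the trust base of `onsager_flexibility` is reduced to exactly these two facts: Prop. 2.1
(mollification, gluing, Mikado perturbation, §§2.3–6 and App. A–D of the paper) and the
time-regularity step (§2.2, p. 6; equivalently Isett's or Colombo–De Rosa's general theorem).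

## The argument (BDSV 2019, §2.2, arXiv pp. 5–6), as formalised

1. *Exponents and constants* (`BDSV.exists_exponents`): `α < β' < β < 1/3`, `1 < b < (1-β)/(2β)`,
   then `M`, `α₀`, a parameter `0 < γ < α₀` (the "`α`" of Prop. 2.1) and `a₀` from Prop. 2.1.
2. *Normalisation (2.9)* (`BDSV.exists_profile_bounds`, `BDSV.exists_scaling`,
   `BDSV.isNormalisedProfile_rescale`): `e` is pinched between `inf e > 0` and `sup e` with
   `|e'| ≤ D` on `[0,T]`; choose `a ≥ a₀` so large that `λ₀^{-γ} ≤ a^{-γ} ≤ inf e / sup e` and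
   `δ₁ ≤ a^{-2β} ≤ sup e/(D+1)` (`Filter.atTop`, `tendsto_rpow_neg_atTop`); with
   `κ = δ₁ / sup e` and `c = (2/κ)^{1/2}` the rescaled profile `e'(s) = κ e(s/c)` on `[0, cT]`
   is smooth, `δ₁ λ₀^{-γ} ≤ e' ≤ δ₁` and `|e''| ≤ κ D / c ≤ 1` (`BDSV.IsNormalisedProfile`). The
   factor `2` in `c²κ = 2` converts BDSV's `∫ |v|² = e` into the tree's `½ ∫ |u|² = e`.
3. *Iteration* (`BDSV.inductiveEstimates_zero`, `BDSV.exists_seq_of_step`): the zero triple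
   satisfies the stage-`0` estimates, and dependent choice along Prop. 2.1 yields
   `(v_q, p_q, R̊_q)_q` with the inductive estimates and
   `‖v_{q+1} - v_q‖₀ + λ_{q+1}^{-1} ‖v_{q+1} - v_q‖₁ ≤ M δ_{q+1}^{1/2}`.
4. *Uniform convergence* (`BDSV.exists_unifLimit_of_norm_sub_succ_le`): `λ_q ≥ a^{1+q(b-1)}`
   (Bernoulli), so `∑_q M δ_{q+1}^{1/2} = ∑_q M λ_{q+1}^{-β}` is dominated by a geometric series
   (`BDSV.summable_freq_rpow_neg`); `v_q → ũ` uniformly on `[0,cT] × T³` with explicit tails, and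
   `‖R̊_q‖₀ ≤ δ_{q+1} → 0`.
5. *Spatial Hölder bounds* (`BDSV.norm_increment_sub_le`): `[w]₁ ≤ B` makes a slice
   `6B`-Lipschitz on `T³` (`Torus.lipschitzWith_of_norm_partialDeriv_le`), and the elementary
   interpolation `min(2σ, L d) ≤ (2σ)^{1-β'} (L d)^{β'}` gives
   `[v_{q+1} - v_q]_{β'} ≤ (2M)^{1-β'} (6M)^{β'} λ_{q+1}^{β'-β}`, summable; hence `[v_q(t)]_{β'}`
   is bounded uniformly in `q, t` (the hypothesis of `BDSV.timeRegularity`).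
6. *Limits*: undo the scaling (`v_q(t) = c ṽ_q(ct)` are again Euler–Reynolds triples,
   `Torus.IsEulerReynoldsOn.timeRescale`); the rescaled limit `u(t) = c ũ(ct)` is a weak Euler
   solution (`Torus.isWeakEulerSolutionOn_of_unifLimit`), is `C^α` in space–time
   (`BDSV.timeRegularity` with `β'' = α < β'`), and `∫ |ũ(s)|² = e'(s)` from
   `δ_{q+1} λ_q^{-γ} ≤ e'(s) - ∫ |v_q(s)|² ≤ δ_{q+1} → 0` (`BDSV.integral_norm_sq_eq_of_unifLimit`),
   so that `½ ∫ |u(t)|² = ½ c² κ e(t) = e(t)`.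

## Design notes

* BDSV fix `T` globally but rescale time in §2.2; accordingly `BDSV.mainIteration` quantifies
  `T` after the parameters, and step 6 uses it on `[0, cT]`.
* The time-regularity step is used as the black box `BDSV.timeRegularity` exactly as transcribed
  in `OnsagerBDSV.lean` (it needs `0 < β' < 1/3`, uniform convergence, `‖R̊_q‖₀ → 0` and uniform
  `C^{β'}_x` bounds, all produced here).
* No `set_option`, no new definitions: this is a pure proofs file over `Onsager.lean`,
  `OnsagerBDSV.lean`, `EulerReynolds.lean` and `TorusHolderBridge.lean`.

## References

* T. Buckmaster, C. De Lellis, L. Székelyhidi Jr., V. Vicol, *Onsager's conjecture for admissible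
  weak solutions*, Comm. Pure Appl. Math. 72 (2019) 229–274 = arXiv:1701.08678: Thm. 1.1, §2.1
  (Prop. 2.1), §2.2 (proof of Thm. 1.1), App. A (A.3) (interpolation of Hölder norms).
-/

open MeasureTheory Set Filter Topology
open scoped NNReal ENNReal ContDiff

noncomputable section

namespace Literature.Analysis.FluidPDE

namespace BDSV

/-! ## Part 0. Generic lemmas -/

section Generic

/-- **Uniform limits from summable increments.** If `‖f_{n+1} - f_n‖ ≤ d_n` on `S × X₂` with
`∑ d_n < ∞`, then `f_n` converges, uniformly on `S × X₂`, to some `g`, with the tail estimate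
`‖f_n - g‖ ≤ ∑_{m} d_{n+m}` (BDSV 2019, §2.2: "by (2.7) `v_q` converges uniformly to some
continuous `v`"). [folklore] -/
theorem exists_unifLimit_of_norm_sub_succ_le {X₁ X₂ Y : Type*} [NormedAddCommGroup Y]
    [CompleteSpace Y] {S : Set X₁} {f : ℕ → X₁ → X₂ → Y} {d : ℕ → ℝ}
    (h : ∀ n, ∀ t ∈ S, ∀ x, ‖f (n + 1) t x - f n t x‖ ≤ d n) (hd : Summable d) :
    ∃ g : X₁ → X₂ → Y, ∀ n, ∀ t ∈ S, ∀ x, ‖f n t x - g t x‖ ≤ ∑' m, d (n + m) := by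
  classical
  have hdist : ∀ t ∈ S, ∀ x, ∀ n, dist (f n t x) (f n.succ t x) ≤ d n := fun t ht x n => by
    rw [dist_comm, dist_eq_norm]
    exact h n t ht x
  have hc : ∀ t ∈ S, ∀ x, CauchySeq (fun n => f n t x) := fun t ht x =>
    cauchySeq_of_dist_le_of_summable d (hdist t ht x) hd
  choose! g hg using fun t (ht : t ∈ S) x => cauchySeq_tendsto_of_complete (hc t ht x)
  refine ⟨g, fun n t ht x => ?_⟩
  have := dist_le_tsum_of_dist_le_of_tendsto d (hdist t ht x) hd (hg t ht x) n
  rwa [dist_eq_norm] at this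

/-- Elementary interpolation: `min(A, B) ≤ A^{1-θ} B^θ` for `A, B ≥ 0`, `θ ∈ [0,1]`. [folklore] -/
theorem min_le_rpow_mul_rpow {A B θ : ℝ} (hA : 0 ≤ A) (hB : 0 ≤ B) (hθ₀ : 0 ≤ θ) (hθ₁ : θ ≤ 1) :
    min A B ≤ A ^ (1 - θ) * B ^ θ := by
  have hsplit : ∀ {C : ℝ}, 0 ≤ C → C = C ^ (1 - θ) * C ^ θ := fun {C} hC => by
    rw [← Real.rpow_add' hC (by norm_num : (1 - θ) + θ ≠ 0), sub_add_cancel, Real.rpow_one]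
  rcases le_total A B with hAB | hAB
  · rw [min_eq_left hAB]
    calc A = A ^ (1 - θ) * A ^ θ := hsplit hA
      _ ≤ A ^ (1 - θ) * B ^ θ := by
          gcongr
  · rw [min_eq_right hAB]
    calc B = B ^ (1 - θ) * B ^ θ := hsplit hB
      _ ≤ A ^ (1 - θ) * B ^ θ := by
          gcongr

/-- **Interpolation between a sup bound and a Lipschitz bound** (BDSV 2019, App. A, (A.3):
`[f]_s ≤ C ‖f‖₀^{1-s/r} [f]_r^{s/r}` with `r = 1`): a map bounded by `σ` and `L`-Lipschitz is
`θ`-Hölder with constant `(2σ)^{1-θ} L^θ`, `θ ∈ [0,1]`. [cite: BuckmasterEtAl2018, App. A (A.3)] -/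
theorem norm_sub_le_interpolate {X Y : Type*} [PseudoMetricSpace X] [NormedAddCommGroup Y]
    {w : X → Y} {σ : ℝ} {L : ℝ≥0} {θ : ℝ} (hσ : ∀ x, ‖w x‖ ≤ σ) (hL : LipschitzWith L w)
    (hθ₀ : 0 ≤ θ) (hθ₁ : θ ≤ 1) (x y : X) :
    ‖w x - w y‖ ≤ (2 * σ) ^ (1 - θ) * (L : ℝ) ^ θ * dist x y ^ θ := by
  have h1 : ‖w x - w y‖ ≤ 2 * σ := (norm_sub_le _ _).trans (by linarith [hσ x, hσ y])
  have h2 : ‖w x - w y‖ ≤ L * dist x y := by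
    rw [← dist_eq_norm]
    exact hL.dist_le_mul x y
  have hσ0 : 0 ≤ 2 * σ := by linarith [norm_nonneg (w x), hσ x]
  calc ‖w x - w y‖ ≤ min (2 * σ) (L * dist x y) := le_min h1 h2
    _ ≤ (2 * σ) ^ (1 - θ) * ((L : ℝ) * dist x y) ^ θ :=
        min_le_rpow_mul_rpow hσ0 (by positivity) hθ₀ hθ₁
    _ = (2 * σ) ^ (1 - θ) * (L : ℝ) ^ θ * dist x y ^ θ := by
        rw [Real.mul_rpow L.coe_nonneg dist_nonneg]
        ring

/-- A real Hölder bound `‖f x - f y‖ ≤ K dist(x,y)^r` is Mathlib's `HolderWith ⟨K⟩ r f`.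
[folklore] -/
theorem holderWith_of_norm_sub_le {X Y : Type*} [PseudoMetricSpace X] [NormedAddCommGroup Y]
    {f : X → Y} {K : ℝ} {r : ℝ≥0} (hK : 0 ≤ K)
    (h : ∀ x y, ‖f x - f y‖ ≤ K * dist x y ^ (r : ℝ)) : HolderWith (Real.toNNReal K) r f := by
  intro x y
  rw [edist_dist, edist_dist, ENNReal.ofReal_rpow_of_nonneg dist_nonneg r.coe_nonneg,
    ← ENNReal.ofReal_coe_nnreal, Real.coe_toNNReal K hK, ← ENNReal.ofReal_mul hK, dist_eq_norm]
  exact ENNReal.ofReal_le_ofReal (h x y)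

end Generic

/-! ## Part 1. Growth of the frequencies `λ_q` and summability of `λ_q^{-γ}` -/

section Parameters

variable {a b : ℝ}

/-- `λ_q ≥ a^{b^q}` (indeed `λ_q ≥ 2π a^{b^q}`, §2.3). [cite: BuckmasterEtAl2018, §2.3] -/
theorem rpow_pow_le_freq (ha : 0 ≤ a) (b : ℝ) (q : ℕ) : a ^ (b ^ q) ≤ freq a b q := by
  have h0 : 0 ≤ a ^ (b ^ q) := Real.rpow_nonneg ha _
  calc a ^ (b ^ q) = 1 * a ^ (b ^ q) := (one_mul _).symm
    _ ≤ 2 * Real.pi * a ^ (b ^ q) := by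
        gcongr
        linarith [Real.two_le_pi]
    _ ≤ freq a b q := two_pi_mul_rpow_le_freq a b q

/-- `λ_q ≥ a^{1 + q(b-1)}` for `a, b ≥ 1` (Bernoulli: `b^q ≥ 1 + q(b-1)`): the frequencies grow at
least geometrically. [folklore] -/
theorem rpow_affine_le_freq (ha : 1 ≤ a) (hb : 1 ≤ b) (q : ℕ) :
    a ^ (1 + q * (b - 1)) ≤ freq a b q := by
  have hbern : 1 + (q : ℝ) * (b - 1) ≤ b ^ q := by
    have := one_add_mul_le_pow (a := b - 1) (by linarith) q
    simpa using this
  exact (Real.rpow_le_rpow_of_exponent_le ha hbern).trans (rpow_pow_le_freq (by linarith) b q)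

/-- `λ_q ≥ a` for `a, b ≥ 1`. [folklore] -/
theorem le_freq (ha : 1 ≤ a) (hb : 1 ≤ b) (q : ℕ) : a ≤ freq a b q := by
  have h1 : a ^ (1 : ℝ) ≤ a ^ (1 + q * (b - 1)) :=
    Real.rpow_le_rpow_of_exponent_le ha (by nlinarith [q.cast_nonneg (α := ℝ)])
  rw [Real.rpow_one] at h1
  exact h1.trans (rpow_affine_le_freq ha hb q)

/-- `λ_q ≥ 1` for `a ≥ 1` (since `λ_q ≥ 2π`). [folklore] -/
theorem one_le_freq (ha : 1 ≤ a) (q : ℕ) : 1 ≤ freq a b q :=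
  le_trans (by linarith [Real.two_le_pi]) (two_pi_le_freq (b := b) ha q)

/-- Geometric majorant: `λ_q^{-γ} ≤ a^{-γ} (a^{-γ(b-1)})^q` for `a > 1`, `b ≥ 1`, `γ ≥ 0`.
[folklore] -/
theorem freq_rpow_neg_le (ha : 1 < a) (hb : 1 ≤ b) {γ : ℝ} (hγ : 0 ≤ γ) (q : ℕ) :
    freq a b q ^ (-γ) ≤ a ^ (-γ) * (a ^ (-(γ * (b - 1)))) ^ q := by
  have ha0 : 0 < a := by linarith
  have h1 : freq a b q ^ (-γ) ≤ (a ^ (1 + q * (b - 1))) ^ (-γ) :=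
    Real.rpow_le_rpow_of_nonpos (Real.rpow_pos_of_pos ha0 _) (rpow_affine_le_freq ha.le hb q)
      (by linarith)
  refine h1.trans (le_of_eq ?_)
  rw [← Real.rpow_mul ha0.le, show (1 + (q : ℝ) * (b - 1)) * -γ = -γ + -(γ * (b - 1)) * q by ring,
    Real.rpow_add ha0, Real.rpow_mul ha0.le, Real.rpow_natCast]

/-- `∑_q λ_q^{-γ} < ∞` for `a > 1`, `b > 1`, `γ > 0` (geometric comparison). [folklore] -/
theorem summable_freq_rpow_neg (ha : 1 < a) (hb : 1 < b) {γ : ℝ} (hγ : 0 < γ) :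
    Summable fun q : ℕ => freq a b q ^ (-γ) := by
  have ha0 : 0 < a := by linarith
  set r : ℝ := a ^ (-(γ * (b - 1))) with hr
  have hr0 : 0 ≤ r := Real.rpow_nonneg ha0.le _
  have hr1 : r < 1 := Real.rpow_lt_one_of_one_lt_of_neg ha (by nlinarith)
  refine Summable.of_nonneg_of_le (fun q => Real.rpow_nonneg (freq_pos ha.le q).le _)
    (fun q => freq_rpow_neg_le ha hb.le hγ.le q) ?_
  exact (summable_geometric_of_lt_one hr0 hr1).mul_left (a ^ (-γ))

/-- The shifted series `∑_q λ_{q+1}^{-γ}` converges as well. [folklore] -/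
theorem summable_freq_succ_rpow_neg (ha : 1 < a) (hb : 1 < b) {γ : ℝ} (hγ : 0 < γ) :
    Summable fun q : ℕ => freq a b (q + 1) ^ (-γ) :=
  (summable_freq_rpow_neg ha hb hγ).comp_injective (add_left_injective 1)

/-- `δ_q^{1/2} = λ_q^{-β}`. [folklore] -/
theorem sqrt_amp (ha : 1 ≤ a) (β b : ℝ) (q : ℕ) : Real.sqrt (amp β a b q) = freq a b q ^ (-β) := by
  rw [amp, Real.sqrt_eq_rpow, ← Real.rpow_mul (freq_pos ha q).le]
  congr 1
  ring

/-- `λ_q^{-γ} ≤ 1` for `a ≥ 1`, `γ ≥ 0`. [folklore] -/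
theorem freq_rpow_neg_le_one (ha : 1 ≤ a) {γ : ℝ} (hγ : 0 ≤ γ) (q : ℕ) : freq a b q ^ (-γ) ≤ 1 :=
  Real.rpow_le_one_of_one_le_of_nonpos (one_le_freq ha q) (by linarith)

/-- `λ_q^{-γ} ≤ a^{-γ}` for `a, b ≥ 1`, `γ ≥ 0`. [folklore] -/
theorem freq_rpow_neg_le_rpow_neg (ha : 1 ≤ a) (hb : 1 ≤ b) {γ : ℝ} (hγ : 0 ≤ γ) (q : ℕ) :
    freq a b q ^ (-γ) ≤ a ^ (-γ) :=
  Real.rpow_le_rpow_of_nonpos (by linarith) (le_freq ha hb q) (by linarith)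

end Parameters

/-! ## Part 2. The energy profile: bounds on `[0,T]` and the rescaled profile -/

section Profile

/-- A smooth strictly positive profile on `[0,T]`, `T > 0`, is pinched between two positive
constants and has bounded (one-sided) derivative there (Weierstrass). [folklore] -/
theorem exists_profile_bounds {T : ℝ} (hT : 0 < T) {e : ℝ → ℝ} (he : ContDiffOn ℝ ∞ e (Icc 0 T))
    (hpos : ∀ t ∈ Icc 0 T, 0 < e t) :
    ∃ emin emax D : ℝ, 0 < emin ∧ emin ≤ emax ∧ 0 ≤ D ∧ (∀ t ∈ Icc 0 T, emin ≤ e t) ∧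
      (∀ t ∈ Icc 0 T, e t ≤ emax) ∧ ∀ t ∈ Icc 0 T, |derivWithin e (Icc 0 T) t| ≤ D := by
  have hc : ContinuousOn e (Icc 0 T) := he.continuousOn
  have hne : (Icc (0 : ℝ) T).Nonempty := nonempty_Icc.2 hT.le
  obtain ⟨t₀, ht₀, hmin⟩ := isCompact_Icc.exists_isMinOn hne hc
  obtain ⟨t₁, ht₁, hmax⟩ := isCompact_Icc.exists_isMaxOn hne hc
  have hd : ContinuousOn (derivWithin e (Icc 0 T)) (Icc 0 T) :=
    he.continuousOn_derivWithin (uniqueDiffOn_Icc hT) (by simp)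
  obtain ⟨D, hD⟩ := isCompact_Icc.exists_bound_of_continuousOn hd
  refine ⟨e t₀, e t₁, max D 0, hpos t₀ ht₀, hmin ht₁, le_max_right _ _, fun t ht => hmin ht,
    fun t ht => hmax ht, fun t ht => ?_⟩
  have := hD t ht
  rw [Real.norm_eq_abs] at this
  exact this.trans (le_max_left _ _)

/-- **The rescaled profile** (BDSV 2019, §2.2, the normalisation (2.9) via the scaling
`v(x,t) ↦ Γ v(x, Γt)`): for `κ, c > 0` the profile `s ↦ κ e(s/c)` is smooth and strictly positive
on `[0, cT]`, and `|d/ds (κ e(s/c))| = κ c⁻¹ |e'(s/c)| ≤ 1` as soon as `κ sup|e'| ≤ c`; it is then a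
normalised profile in the sense of Prop. 2.1 (`BDSV.IsNormalisedProfile`).
[cite: BuckmasterEtAl2018, §2.2 (2.9)] -/
theorem isNormalisedProfile_rescale {T : ℝ} (hT : 0 < T) {e : ℝ → ℝ}
    (he : ContDiffOn ℝ ∞ e (Icc 0 T)) (hpos : ∀ t ∈ Icc 0 T, 0 < e t) {D : ℝ}
    (hD : ∀ t ∈ Icc 0 T, |derivWithin e (Icc 0 T) t| ≤ D) {κ c : ℝ} (hκ : 0 < κ) (hc : 0 < c)
    (hκcD : κ * D ≤ c) : IsNormalisedProfile (c * T) (fun s => κ * e (c⁻¹ * s)) := by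
  have hcT : 0 < c * T := mul_pos hc hT
  have hmaps : MapsTo (fun s : ℝ => c⁻¹ * s) (Icc 0 (c * T)) (Icc 0 T) := by
    intro s hs
    refine ⟨mul_nonneg (inv_nonneg.2 hc.le) hs.1, ?_⟩
    calc c⁻¹ * s ≤ c⁻¹ * (c * T) := mul_le_mul_of_nonneg_left hs.2 (inv_nonneg.2 hc.le)
      _ = T := by field_simp
  have hlin : ContDiffOn ℝ ∞ (fun s : ℝ => c⁻¹ * s) (Icc 0 (c * T)) :=
    contDiffOn_const.mul contDiffOn_id
  have hcomp : ContDiffOn ℝ ∞ (fun s => e (c⁻¹ * s)) (Icc 0 (c * T)) := he.comp hlin hmaps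
  refine ⟨contDiffOn_const.mul hcomp, fun s hs => mul_pos hκ (hpos _ (hmaps hs)), fun s hs => ?_⟩
  have h1 : HasDerivWithinAt e (derivWithin e (Icc 0 T) (c⁻¹ * s)) (Icc 0 T) (c⁻¹ * s) :=
    ((he.differentiableOn (by simp)) _ (hmaps hs)).hasDerivWithinAt
  have h2 : HasDerivWithinAt (fun s : ℝ => c⁻¹ * s) c⁻¹ (Icc 0 (c * T)) s := by
    simpa using (hasDerivWithinAt_id s (Icc 0 (c * T))).const_mul c⁻¹
  have h3 := ((h1.scomp s h2 hmaps).const_mul κ).derivWithin (uniqueDiffOn_Icc hcT s hs)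
  have h4 : derivWithin (fun s => κ * e (c⁻¹ * s)) (Icc 0 (c * T)) s =
      κ * (c⁻¹ * derivWithin e (Icc 0 T) (c⁻¹ * s)) := by
    simpa [Function.comp_def] using h3
  rw [h4, abs_mul, abs_mul, abs_of_pos hκ, abs_of_pos (inv_pos.2 hc)]
  have hDs := hD _ (hmaps hs)
  calc κ * (c⁻¹ * |derivWithin e (Icc 0 T) (c⁻¹ * s)|) ≤ κ * (c⁻¹ * D) := by gcongr
    _ = (κ * D) / c := by ring
    _ ≤ 1 := by rwa [div_le_one hc]

end Profile

/-! ## Part 3. Hölder bounds for the velocity increments -/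

section Increments

/-- **`[w]₁`-bounds are Lipschitz bounds.** A smooth slice `w(t)` with `[w]₁ ≤ B` in BDSV's
notation (`BDSV.DerivSupLE`: all first partials bounded by `B`) is `6B`-Lipschitz for the flat
metric of `T³` (mean value inequality along good lifts, `√3 · 3B ≤ 6B`;
`Torus.lipschitzWith_of_norm_partialDeriv_le`). [folklore] -/
theorem lipschitzWith_of_derivSupLE {T : ℝ}
    {w : ℝ → UnitAddTorus (Fin 3) → EuclideanSpace ℝ (Fin 3)} {B : ℝ}
    (hB : 0 ≤ B) (hder : DerivSupLE T w B) {t : ℝ} (ht : t ∈ Icc 0 T)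
    (hw : FunctionSpaces.Torus.IsSmooth (w t)) :
    LipschitzWith (Real.toNNReal (6 * B)) (w t) := by
  have hL := FunctionSpaces.Torus.lipschitzWith_of_norm_partialDeriv_le (hw.isContDiff (by simp))
    (M := fun _ : Fin 3 => Real.toNNReal B) (fun i x => by
      rw [Real.coe_toNNReal B hB]; exact hder i t ht x)
  refine hL.weaken ?_
  rw [← NNReal.coe_le_coe]
  have h3 : Real.sqrt 3 ≤ 2 := by rw [Real.sqrt_le_left (by norm_num)]; norm_num
  push_cast
  rw [Real.coe_toNNReal B hB, Real.coe_toNNReal _ (by positivity)]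
  simp only [Finset.sum_const, Finset.card_univ, Fintype.card_fin, nsmul_eq_mul, Nat.cast_ofNat]
  nlinarith

/-- The algebra of the interpolated Hölder constant of one increment:
`(2 M λ^{-β})^{1-θ} (6 λ · M λ^{-β})^θ = (2M)^{1-θ} (6M)^θ λ^{θ-β}` (BDSV 2019, §2.2:
`‖v_{q+1}-v_q‖₀^{1-β'} ‖v_{q+1}-v_q‖₁^{β'} ≲ δ_{q+1}^{(1-β')/2} (δ_{q+1}^{1/2} λ_{q+1})^{β'}`
`≲ λ_{q+1}^{β'-β}`). [cite: BuckmasterEtAl2018, §2.2] -/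
theorem holderConst_eq {M f β θ : ℝ} (hf : 0 < f) (hM : 0 ≤ M) :
    (2 * (M * f ^ (-β))) ^ (1 - θ) * (6 * (f * (M * f ^ (-β)))) ^ θ =
      ((2 * M) ^ (1 - θ) * (6 * M) ^ θ) * f ^ (θ - β) := by
  have e1 : f * (M * f ^ (-β)) = M * f ^ (1 - β) := by
    rw [show (1 - β) = 1 + -β by ring, Real.rpow_add hf, Real.rpow_one]; ring
  rw [e1, show 2 * (M * f ^ (-β)) = (2 * M) * f ^ (-β) by ring,
    show 6 * (M * f ^ (1 - β)) = (6 * M) * f ^ (1 - β) by ring,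
    Real.mul_rpow (by positivity) (Real.rpow_nonneg hf.le _),
    Real.mul_rpow (by positivity) (Real.rpow_nonneg hf.le _),
    ← Real.rpow_mul hf.le, ← Real.rpow_mul hf.le]
  rw [show (2 * M) ^ (1 - θ) * f ^ (-β * (1 - θ)) * ((6 * M) ^ θ * f ^ ((1 - β) * θ)) =
      (2 * M) ^ (1 - θ) * (6 * M) ^ θ * (f ^ (-β * (1 - θ)) * f ^ ((1 - β) * θ)) by ring,
    ← Real.rpow_add hf]
  congr 1
  ring_nf

end Increments

/-! ## Part 4. Lemmas for the assembly: exponents, scaling constants, the iteration, increments,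
and the energy at the limit -/

section AssemblyLemmas

/-- Choice of exponents `α < β' < β < 1/3` (BDSV 2019, §2.2: "`β'' < β' < β < 1/3`
arbitrary"). [folklore] -/
theorem exists_exponents {α : ℝ≥0} (hα : α < 1 / 3) :
    ∃ (β' : ℝ≥0) (β : ℝ), α < β' ∧ 0 < β' ∧ β' < 1 / 3 ∧ (β' : ℝ) ≤ 1 ∧ (β' : ℝ) < β ∧
      0 < β ∧ β < 1 / 3 := by
  have hα' : (α : ℝ) < 1 / 3 := by exact_mod_cast hα
  have hα0 : (0 : ℝ) ≤ α := α.coe_nonneg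
  refine ⟨(α + 1 / 3) / 2, (((α : ℝ) + 1 / 3) / 2 + 1 / 3) / 2, ?_, ?_, ?_, ?_, ?_, ?_, ?_⟩
  · rw [← NNReal.coe_lt_coe]; push_cast; linarith
  · rw [← NNReal.coe_pos]; push_cast; linarith
  · rw [← NNReal.coe_lt_coe]; push_cast; linarith
  · push_cast; linarith
  · push_cast; linarith
  · linarith
  · linarith

/-- The scaling constants of §2.2: given `δ₁ ≤ sup e / (sup|e'| + 1)`, the numbers
`κ = δ₁ / sup e` and `c = Γ⁻¹ = (2/κ)^{1/2} ≥ 1` satisfy `κ sup e = δ₁`, `c² κ = 2` and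
`κ sup|e'| ≤ c` (BDSV 2019, §2.2, `Γ = (δ₁ / sup e)^{1/2}`; the factor `2` converts BDSV's
`∫ |v|² = e` into the tree's `½ ∫ |u|² = e`). [cite: BuckmasterEtAl2018, §2.2 (2.9)] -/
theorem exists_scaling {δ₁ emax D : ℝ} (hδ₁ : 0 < δ₁) (hemax : 0 < emax) (hD : 0 ≤ D)
    (h : δ₁ ≤ emax / (D + 1)) :
    ∃ κ c : ℝ, 0 < κ ∧ 1 ≤ c ∧ κ * emax = δ₁ ∧ c ^ 2 * κ = 2 ∧ κ * D ≤ c := by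
  set κ : ℝ := δ₁ / emax with hκdef
  have hκ : 0 < κ := div_pos hδ₁ hemax
  have hκD1 : κ * (D + 1) ≤ 1 := by
    rw [hκdef, div_mul_eq_mul_div, div_le_one hemax]
    calc δ₁ * (D + 1) ≤ emax / (D + 1) * (D + 1) := by gcongr
      _ = emax := by field_simp
  have hκ2 : κ ≤ 2 := by nlinarith
  have hc1 : 1 ≤ Real.sqrt (2 / κ) := by
    rw [Real.le_sqrt (by norm_num) (by positivity), one_pow, le_div_iff₀ hκ]
    linarith
  refine ⟨κ, Real.sqrt (2 / κ), hκ, hc1, ?_, ?_, ?_⟩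
  · rw [hκdef]; field_simp
  · rw [Real.sq_sqrt (by positivity)]; field_simp
  · nlinarith

/-- The start of the iteration: the zero triple satisfies the inductive estimates at stage
`q = 0` as soon as `δ₁ λ₀^{-α} ≤ e ≤ δ₁` on `[0,T]` (BDSV 2019, §2.2: "the pair `(v₀, R₀)`
trivially satisfies (2.3)–(2.5), whereas (2.6) and (2.1) follow from (2.9)").
[cite: BuckmasterEtAl2018, §2.2] -/
theorem inductiveEstimates_zero {M β γ a b T : ℝ} {e : ℝ → ℝ} (hM : 0 ≤ M) (ha : 1 ≤ a)
    (hβ : 0 ≤ β) (hup : ∀ t ∈ Icc 0 T, e t ≤ amp β a b 1)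
    (hlow : ∀ t ∈ Icc 0 T, amp β a b 1 * freq a b 0 ^ (-γ) ≤ e t) :
    InductiveEstimates M β γ a b T e 0 (fun _ _ => 0) (fun _ _ _ => 0) where
  stress_le t ht x := by
    change ‖(0 : Fin 3 → EuclideanSpace ℝ (Fin 3))‖ ≤ _
    rw [norm_zero]
    exact mul_nonneg (amp_pos ha 1).le (Real.rpow_nonneg (freq_pos ha 0).le _)
  velocity_C1_le := ⟨0, 0, supLE_zero T, derivSupLE_zero T, by
    rw [add_zero]
    exact mul_nonneg (mul_nonneg hM (Real.sqrt_nonneg _)) (freq_pos ha 0).le⟩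
  velocity_le t ht x := by
    change ‖(0 : EuclideanSpace ℝ (Fin 3))‖ ≤ _
    rw [norm_zero, sub_nonneg]
    exact Real.sqrt_le_one.2 (amp_le_one ha hβ 0)
  energy_ge t ht := by simpa using hlow t ht
  energy_le t ht := by simpa using hup t ht

/-- **The iteration** (dependent choice): if every state satisfying the stage-`q` property can be
improved to a state with the stage-`(q+1)` property, related to it by `Q q`, and `x₀` satisfies
the stage-`0` property, there is a whole sequence from `x₀` (BDSV 2019, §2.2: "we apply
Proposition 2.1 iteratively with `(v₀, R₀, p₀) = (0, 0, 0)`"). [folklore] -/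
theorem exists_seq_of_step {X : Type*} {P : ℕ → X → Prop} {Q : ℕ → X → X → Prop} {x₀ : X}
    (h0 : P 0 x₀) (step : ∀ q x, P q x → ∃ y, P (q + 1) y ∧ Q q x y) :
    ∃ Z : ℕ → X, Z 0 = x₀ ∧ (∀ q, P q (Z q)) ∧ ∀ q, Q q (Z q) (Z (q + 1)) := by
  classical
  haveI : Nonempty X := ⟨x₀⟩
  choose! Φ hΦ using step
  let Z : ℕ → X := fun q => Nat.rec (motive := fun _ => X) x₀ (fun q z => Φ q z) q
  have hZs : ∀ q, Z (q + 1) = Φ q (Z q) := fun q => rfl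
  have hgood : ∀ q, P q (Z q) := by
    intro q
    induction q with
    | zero => exact h0
    | succ q ih => rw [hZs]; exact (hΦ q (Z q) ih).1
  exact ⟨Z, rfl, hgood, fun q => by rw [hZs]; exact (hΦ q (Z q) (hgood q)).2⟩

/-- Unpacking the increment estimate of Prop. 2.1: `‖w‖₀ ≤ M λ_{q+1}^{-β} = M δ_{q+1}^{1/2}` and
`[w]₁ ≤ λ_{q+1} · M δ_{q+1}^{1/2}` with nonnegative bounds (for `T ≥ 0`).
[cite: BuckmasterEtAl2018, Prop. 2.1] -/
theorem VelocityIncrementBound.exists_bounds {M β a b T : ℝ} {q : ℕ}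
    {w : ℝ → UnitAddTorus (Fin 3) → EuclideanSpace ℝ (Fin 3)}
    (h : VelocityIncrementBound M β a b T q w) (hT : 0 ≤ T) (ha : 1 ≤ a) :
    ∃ B₀ B₁ : ℝ, 0 ≤ B₀ ∧ 0 ≤ B₁ ∧ SupLE T w B₀ ∧ DerivSupLE T w B₁ ∧
      B₀ ≤ M * freq a b (q + 1) ^ (-β) ∧
      B₁ ≤ freq a b (q + 1) * (M * freq a b (q + 1) ^ (-β)) := by
  obtain ⟨B₀, B₁, hsup, hder, hle⟩ := h
  have h0T : (0 : ℝ) ∈ Icc 0 T := ⟨le_rfl, hT⟩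
  have hB₀ : 0 ≤ B₀ := (norm_nonneg _).trans (hsup 0 h0T 0)
  have hB₁ : 0 ≤ B₁ := (norm_nonneg _).trans (hder 0 0 h0T 0)
  rw [sqrt_amp ha] at hle
  have hl := freq_pos (b := b) ha (q + 1)
  have hfrac : 0 ≤ (freq a b (q + 1))⁻¹ * (B₀ + B₁) := by positivity
  refine ⟨B₀, B₁, hB₀, hB₁, hsup, hder, by linarith, ?_⟩
  have h2 : (freq a b (q + 1))⁻¹ * (B₀ + B₁) ≤ M * freq a b (q + 1) ^ (-β) := by linarith
  have h3 : B₀ + B₁ ≤ freq a b (q + 1) * (M * freq a b (q + 1) ^ (-β)) := by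
    have := mul_le_mul_of_nonneg_left h2 hl.le
    rwa [← mul_assoc, mul_inv_cancel₀ hl.ne', one_mul] at this
  linarith

/-- **Interpolated Hölder bound for one increment** (BDSV 2019, §2.2:
`‖v_{q+1} - v_q‖_{β'} ≲ ‖v_{q+1} - v_q‖₀^{1-β'} ‖v_{q+1} - v_q‖₁^{β'} ≲ λ_{q+1}^{β'-β}`): for
consecutive triples of the scheme and `θ ∈ [0,1]`,
`|w(t,x) - w(t,y)| ≤ (2M)^{1-θ} (6M)^θ λ_{q+1}^{θ-β} dist(x,y)^θ`, `w = v_{q+1} - v_q`.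
[cite: BuckmasterEtAl2018, §2.2] -/
theorem norm_increment_sub_le {M β a b T : ℝ} {q : ℕ}
    {v v' : ℝ → UnitAddTorus (Fin 3) → EuclideanSpace ℝ (Fin 3)}
    {p p' : ℝ → UnitAddTorus (Fin 3) → ℝ}
    {R R' : ℝ → UnitAddTorus (Fin 3) → Fin 3 → EuclideanSpace ℝ (Fin 3)}
    (hv : Torus.IsEulerReynoldsOn (Icc 0 T) v p R)
    (hv' : Torus.IsEulerReynoldsOn (Icc 0 T) v' p' R')
    (hVI : VelocityIncrementBound M β a b T q (fun t x => v' t x - v t x)) (hT : 0 ≤ T)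
    (ha : 1 ≤ a) (hM : 0 ≤ M) {θ : ℝ} (hθ0 : 0 ≤ θ) (hθ1 : θ ≤ 1) {t : ℝ} (ht : t ∈ Icc 0 T)
    (x y : UnitAddTorus (Fin 3)) :
    ‖(v' t x - v t x) - (v' t y - v t y)‖ ≤
      ((2 * M) ^ (1 - θ) * (6 * M) ^ θ * freq a b (q + 1) ^ (θ - β)) * dist x y ^ θ := by
  obtain ⟨B₀, B₁, hB₀, hB₁, hsup, hder, hB₀ε, hB₁ε⟩ := hVI.exists_bounds hT ha
  have hw : FunctionSpaces.Torus.IsSmooth (fun x => v' t x - v t x) :=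
    (hv'.smooth_velocity.isSmooth_slice ht).sub (hv.smooth_velocity.isSmooth_slice ht)
  have hLip := lipschitzWith_of_derivSupLE hB₁ hder ht hw
  have hint := norm_sub_le_interpolate (w := fun x => v' t x - v t x)
    (fun x => hsup t ht x) hLip hθ0 hθ1 x y
  refine hint.trans ?_
  rw [Real.coe_toNNReal _ (by positivity)]
  have hl := freq_pos (b := b) ha (q + 1)
  have hd : 0 ≤ dist x y ^ θ := Real.rpow_nonneg dist_nonneg _
  refine mul_le_mul_of_nonneg_right ?_ hd
  calc (2 * B₀) ^ (1 - θ) * (6 * B₁) ^ θ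
      ≤ (2 * (M * freq a b (q + 1) ^ (-β))) ^ (1 - θ) *
          (6 * (freq a b (q + 1) * (M * freq a b (q + 1) ^ (-β)))) ^ θ := by
        gcongr
    _ = (2 * M) ^ (1 - θ) * (6 * M) ^ θ * freq a b (q + 1) ^ (θ - β) := holderConst_eq hl hM

/-- **Energy at the limit** (BDSV 2019, §2.2, last display: "since `δ_{q+1} → 0`, from (2.6)
we have `∫ |v|² = e(t)`"): if continuous slices `w_q(s)`, bounded by `1`, converge uniformly to
`u(s)` and `|e(s) - ∫ |w_q(s)|²| ≤ ρ_q → 0`, then `∫ |u(s)|² = e(s)`.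
[cite: BuckmasterEtAl2018, §2.2] -/
theorem integral_norm_sq_eq_of_unifLimit {S : Set ℝ}
    {w : ℕ → ℝ → UnitAddTorus (Fin 3) → EuclideanSpace ℝ (Fin 3)}
    {u : ℝ → UnitAddTorus (Fin 3) → EuclideanSpace ℝ (Fin 3)} {e : ℝ → ℝ}
    {ρ τ : ℕ → ℝ} (hwc : ∀ q, ∀ s ∈ S, Continuous (w q s))
    (huc : ∀ s ∈ S, Continuous (u s)) (hw1 : ∀ q, ∀ s ∈ S, ∀ x, ‖w q s x‖ ≤ 1)
    (hconv : ∀ q, ∀ s ∈ S, ∀ x, ‖w q s x - u s x‖ ≤ τ q) (hτ0 : ∀ q, 0 ≤ τ q)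
    (hτ : Tendsto τ atTop (𝓝 0)) (hpinch : ∀ q, ∀ s ∈ S, |e s - ∫ x, ‖w q s x‖ ^ 2| ≤ ρ q)
    (hρ : Tendsto ρ atTop (𝓝 0)) {s : ℝ} (hs : s ∈ S) : ∫ x, ‖u s x‖ ^ 2 = e s := by
  have key : ∀ q, |e s - ∫ x, ‖u s x‖ ^ 2| ≤ ρ q + (2 + τ q) * τ q := by
    intro q
    have hi1 : Integrable (fun x => ‖w q s x‖ ^ 2) volume :=
      ((hwc q s hs).norm.pow 2).integrable_unitAddTorus
    have hi2 : Integrable (fun x => ‖u s x‖ ^ 2) volume :=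
      ((huc s hs).norm.pow 2).integrable_unitAddTorus
    have hpt : ∀ x, |‖w q s x‖ ^ 2 - ‖u s x‖ ^ 2| ≤ (2 + τ q) * τ q := by
      intro x
      have ha' : ‖w q s x‖ ≤ 1 := hw1 q s hs x
      have hd : ‖w q s x - u s x‖ ≤ τ q := hconv q s hs x
      have hb' : ‖u s x‖ ≤ 1 + τ q :=
        (norm_le_norm_add_norm_sub (w q s x) (u s x)).trans (add_le_add ha' hd)
      rw [sq_sub_sq, abs_mul]
      have hsum : |‖w q s x‖ + ‖u s x‖| ≤ 2 + τ q := by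
        rw [abs_of_nonneg (by positivity)]
        linarith
      exact mul_le_mul hsum ((abs_norm_sub_norm_le _ _).trans hd) (abs_nonneg _)
        (by linarith [hτ0 q])
    have h2 : |(∫ x, ‖w q s x‖ ^ 2) - ∫ x, ‖u s x‖ ^ 2| ≤ (2 + τ q) * τ q := by
      rw [← integral_sub hi1 hi2]
      have := norm_integral_le_of_norm_le_const (μ := (volume : Measure (UnitAddTorus (Fin 3))))
        (f := fun x => ‖w q s x‖ ^ 2 - ‖u s x‖ ^ 2) (C := (2 + τ q) * τ q)
        (ae_of_all _ fun x => by rw [Real.norm_eq_abs]; exact hpt x)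
      rwa [probReal_univ, mul_one, Real.norm_eq_abs] at this
    calc |e s - ∫ x, ‖u s x‖ ^ 2|
        = |(e s - ∫ x, ‖w q s x‖ ^ 2) + ((∫ x, ‖w q s x‖ ^ 2) - ∫ x, ‖u s x‖ ^ 2)| := by
          ring_nf
      _ ≤ |e s - ∫ x, ‖w q s x‖ ^ 2| + |(∫ x, ‖w q s x‖ ^ 2) - ∫ x, ‖u s x‖ ^ 2| :=
          abs_add_le _ _
      _ ≤ ρ q + (2 + τ q) * τ q := add_le_add (hpinch q s hs) h2
  have hlim : Tendsto (fun q => ρ q + (2 + τ q) * τ q) atTop (𝓝 0) := by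
    have := hρ.add (((tendsto_const_nhds (x := (2 : ℝ))).add hτ).mul hτ)
    simpa using this
  have h0 : |e s - ∫ x, ‖u s x‖ ^ 2| ≤ 0 :=
    le_of_tendsto_of_tendsto' tendsto_const_nhds hlim key
  have := abs_nonpos_iff.1 h0
  linarith

end AssemblyLemmas

end BDSV

/-! ## Part 5. The assembly: Prop. 2.1 and the time-regularity step imply Thm. 1.1 -/

section Assembly

/-- **Onsager flexibility from the BDSV scheme** (Buckmaster–De Lellis–Székelyhidi–Vicol 2019,
§2.2 "Proof of Theorem 1.1"): the main iterative proposition (Prop. 2.1, the named fact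
`BDSV.mainIteration`) together with the time-regularity step of §2.2 (the named fact
`BDSV.timeRegularity`) imply Thm. 1.1 in the form `onsager_flexibility`. The proof is that of
§2.2: normalise the profile by the scaling `v(x,t) ↦ Γ v(x, Γt)` and a large `a` ((2.9)), iterate
Prop. 2.1 from `(v₀, p₀, R̊₀) = (0, 0, 0)`, sum the increments `‖v_{q+1} - v_q‖₀ ≤ M δ_{q+1}^{1/2}`
(uniform convergence), interpolate them against `‖v_{q+1} - v_q‖₁ ≤ M δ_{q+1}^{1/2} λ_{q+1}`
(uniform `C^{β'}_x` bounds, `β' < β`), pass to the limit in the Euler–Reynolds system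
(`Torus.isWeakEulerSolutionOn_of_unifLimit`) and in the energy pinching
`δ_{q+1} λ_q^{-α} ≤ e(t) - ∫ |v_q|² ≤ δ_{q+1}`, and undo the scaling.
[cite: BuckmasterEtAl2018, §2.2 (proof of Thm. 1.1)] -/
theorem onsager_flexibility_of_bdsv (hmain : BDSV.mainIteration) (htime : BDSV.timeRegularity) :
    onsager_flexibility := by
  intro α hα T hT e he hpos
  /- Step 0: exponents `α < β' < β < 1/3`, `b`, and the constants `M, α₀, a₀` of Prop. 2.1. -/
  obtain ⟨β', β, hαβ', hβ'pos, hβ'lt, hβ'1, hβ'β, hβpos, hβlt⟩ := BDSV.exists_exponents hα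
  have hβ'0 : (0 : ℝ) ≤ β' := β'.coe_nonneg
  obtain ⟨b, hb1, hb2⟩ : ∃ b : ℝ, 1 < b ∧ b < (1 - β) / (2 * β) := by
    have hbub : 1 < (1 - β) / (2 * β) := by rw [lt_div_iff₀ (by positivity)]; linarith
    exact ⟨(1 + (1 - β) / (2 * β)) / 2, by linarith, by linarith⟩
  obtain ⟨M, hM, hmain₁⟩ := hmain
  obtain ⟨α₀, hα₀, hmain₂⟩ := hmain₁ β hβpos hβlt b hb1 hb2
  clear hmain₁
  obtain ⟨γ, hγ0, hγ1⟩ : ∃ γ : ℝ, 0 < γ ∧ γ < α₀ := ⟨α₀ / 2, by positivity, by linarith⟩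
  obtain ⟨a₀, -, hmain₃⟩ := hmain₂ γ hγ0 hγ1
  clear hmain₂
  /- Step 1: bounds of the profile on `[0,T]`. -/
  obtain ⟨emin, emax, D, hemin, hminmax, hD0, hmin, hmax, hD⟩ :=
    BDSV.exists_profile_bounds hT he hpos
  have hemax : 0 < emax := lt_of_lt_of_le hemin hminmax
  /- Step 2: choice of a large `a ≥ a₀` ((2.9): `inf e / sup e ≥ λ₀^{-α}` and `δ₁` small). -/
  have hev : ∀ᶠ a : ℝ in atTop, a₀ ≤ a ∧ 2 ≤ a ∧ a ^ (-γ) ≤ emin / emax ∧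
      a ^ (-(2 * β)) ≤ emax / (D + 1) :=
    (eventually_ge_atTop a₀).and ((eventually_ge_atTop 2).and
      (((tendsto_rpow_neg_atTop hγ0).eventually_le_const (div_pos hemin hemax)).and
        ((tendsto_rpow_neg_atTop (by positivity)).eventually_le_const (by positivity))))
  obtain ⟨a, ha₀a, ha2, haγ, haβ⟩ := hev.exists
  have ha1 : (1 : ℝ) < a := by linarith
  have hA₀ := hmain₃ a ha₀a
  clear hmain₃ hev
  have hlam_pos : ∀ q, 0 < BDSV.freq a b q := fun q => BDSV.freq_pos ha1.le q
  have hδ_pos : ∀ q, 0 < BDSV.amp β a b q := fun q => BDSV.amp_pos ha1.le q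
  have hδeq : ∀ q, BDSV.amp β a b q = BDSV.freq a b q ^ (-(2 * β)) := fun q => by
    rw [BDSV.amp, neg_mul]
  have hδ1 : BDSV.amp β a b 1 ≤ emax / (D + 1) := by
    rw [hδeq]
    exact (BDSV.freq_rpow_neg_le_rpow_neg ha1.le hb1.le (by positivity) 1).trans haβ
  have hlam0 : BDSV.freq a b 0 ^ (-γ) ≤ emin / emax :=
    (BDSV.freq_rpow_neg_le_rpow_neg ha1.le hb1.le hγ0.le 0).trans haγ
  /- Step 3: the scaling constants and the rescaled profile `e'(s) = κ e(s/c)` on `[0, cT]`. -/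
  obtain ⟨κ, c, hκ, hc1, hκemax, hκc, hκDc⟩ := BDSV.exists_scaling (hδ_pos 1) hemax hD0 hδ1
  have hc : 0 < c := by linarith
  have hT' : 0 < c * T := mul_pos hc hT
  have he' : BDSV.IsNormalisedProfile (c * T) (fun s => κ * e (c⁻¹ * s)) :=
    BDSV.isNormalisedProfile_rescale hT he hpos hD hκ hc hκDc
  have hmaps : ∀ s ∈ Icc 0 (c * T), c⁻¹ * s ∈ Icc 0 T := by
    intro s hs
    refine ⟨mul_nonneg (inv_nonneg.2 hc.le) hs.1, ?_⟩
    calc c⁻¹ * s ≤ c⁻¹ * (c * T) := mul_le_mul_of_nonneg_left hs.2 (inv_nonneg.2 hc.le)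
      _ = T := by field_simp
  have he'le : ∀ s ∈ Icc 0 (c * T), κ * e (c⁻¹ * s) ≤ BDSV.amp β a b 1 := fun s hs => by
    calc κ * e (c⁻¹ * s) ≤ κ * emax := by gcongr; exact hmax _ (hmaps s hs)
      _ = BDSV.amp β a b 1 := hκemax
  have he'ge : ∀ s ∈ Icc 0 (c * T),
      BDSV.amp β a b 1 * BDSV.freq a b 0 ^ (-γ) ≤ κ * e (c⁻¹ * s) := fun s hs => by
    calc BDSV.amp β a b 1 * BDSV.freq a b 0 ^ (-γ) ≤ BDSV.amp β a b 1 * (emin / emax) := by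
          gcongr
          exact (hδ_pos 1).le
      _ = κ * emin := by rw [← hκemax]; field_simp
      _ ≤ κ * e (c⁻¹ * s) := by gcongr; exact hmin _ (hmaps s hs)
  /- Step 4: the iteration `(v_q, p_q, R̊_q)`, `q ∈ ℕ`, from `(0, 0, 0)` (Prop. 2.1). -/
  have hA := hA₀ (c * T) hT' _ he'
  clear hA₀
  obtain ⟨Z, hZ0, hgood, hVI⟩ := BDSV.exists_seq_of_step
    (X := (ℝ → UnitAddTorus (Fin 3) → EuclideanSpace ℝ (Fin 3)) × (ℝ → UnitAddTorus (Fin 3) → ℝ) ×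
      (ℝ → UnitAddTorus (Fin 3) → Fin 3 → EuclideanSpace ℝ (Fin 3)))
    (P := fun q z => Torus.IsEulerReynoldsOn (Icc 0 (c * T)) z.1 z.2.1 z.2.2 ∧
      BDSV.InductiveEstimates M β γ a b (c * T) (fun s => κ * e (c⁻¹ * s)) q z.1 z.2.2)
    (Q := fun q z z' => BDSV.VelocityIncrementBound M β a b (c * T) q
      (fun t x => z'.1 t x - z.1 t x))
    (x₀ := (fun _ _ => 0, fun _ _ => 0, fun _ _ _ => 0))
    ⟨Torus.isEulerReynoldsOn_zero _,
      BDSV.inductiveEstimates_zero hM.le ha1.le hβpos.le he'le he'ge⟩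
    (by
      rintro q ⟨v, p, R⟩ ⟨h1, h2⟩
      obtain ⟨v', p', R', h1', h2', h3'⟩ := hA q v p R h1 h2
      exact ⟨(v', p', R'), ⟨h1', h2'⟩, h3'⟩)
  clear hA
  have hER : ∀ q, Torus.IsEulerReynoldsOn (Icc 0 (c * T)) (Z q).1 (Z q).2.1 (Z q).2.2 :=
    fun q => (hgood q).1
  have hIE : ∀ q, BDSV.InductiveEstimates M β γ a b (c * T) (fun s => κ * e (c⁻¹ * s)) q
      (Z q).1 (Z q).2.2 := fun q => (hgood q).2
  /- Step 5: `‖v_{q+1} - v_q‖₀ ≤ ε_q := M λ_{q+1}^{-β}`, summable, and its tails. -/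
  have hε_sum : Summable fun q : ℕ => M * BDSV.freq a b (q + 1) ^ (-β) :=
    (BDSV.summable_freq_succ_rpow_neg ha1 hb1 hβpos).mul_left M
  have hincr : ∀ q, ∀ t ∈ Icc 0 (c * T), ∀ x,
      ‖(Z (q + 1)).1 t x - (Z q).1 t x‖ ≤ M * BDSV.freq a b (q + 1) ^ (-β) := by
    intro q t ht x
    obtain ⟨B₀, B₁, -, -, hsup, -, hB₀ε, -⟩ := (hVI q).exists_bounds hT'.le ha1.le
    exact (hsup t ht x).trans hB₀ε
  obtain ⟨ũ, hũ⟩ := BDSV.exists_unifLimit_of_norm_sub_succ_le (S := Icc 0 (c * T))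
    (f := fun q => (Z q).1) hincr hε_sum
  obtain ⟨tail, htaildef⟩ : ∃ tail : ℕ → ℝ,
      tail = fun n => ∑' m, M * BDSV.freq a b (n + m + 1) ^ (-β) := ⟨_, rfl⟩
  have hũ' : ∀ q, ∀ t ∈ Icc 0 (c * T), ∀ x, ‖(Z q).1 t x - ũ t x‖ ≤ tail q := by
    rw [htaildef]; exact hũ
  have htail_nn : ∀ n, 0 ≤ tail n := fun n => by
    rw [htaildef]
    exact tsum_nonneg fun m => mul_nonneg hM.le (Real.rpow_nonneg (hlam_pos _).le _)
  have htail : Tendsto tail atTop (𝓝 0) := by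
    have h1 : tail = fun i => ∑' k, (fun q => M * BDSV.freq a b (q + 1) ^ (-β)) (k + i) := by
      rw [htaildef]
      funext i
      exact tsum_congr fun k => by rw [add_comm i k]
    rw [h1]
    exact tendsto_sum_nat_add fun q => M * BDSV.freq a b (q + 1) ^ (-β)
  have hconvT' : ∀ η > 0, ∃ N : ℕ, ∀ q ≥ N, ∀ t ∈ Icc 0 (c * T), ∀ x,
      ‖(Z q).1 t x - ũ t x‖ ≤ η := by
    intro η hη
    obtain ⟨N, hN⟩ := eventually_atTop.1 (htail.eventually_le_const hη)
    exact ⟨N, fun q hq t ht x => (hũ' q t ht x).trans (hN q hq)⟩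
  have hδ_tend : Tendsto (fun q => BDSV.amp β a b (q + 1)) atTop (𝓝 0) :=
    (BDSV.summable_freq_succ_rpow_neg ha1 hb1
      (by positivity : (0 : ℝ) < 2 * β)).tendsto_atTop_zero.congr fun q => (hδeq (q + 1)).symm
  have hstressT' : ∀ η > 0, ∃ N : ℕ, ∀ q ≥ N, ∀ t ∈ Icc 0 (c * T), ∀ x,
      ‖(Z q).2.2 t x‖ ≤ η := by
    intro η hη
    obtain ⟨N, hN⟩ := eventually_atTop.1 (hδ_tend.eventually_le_const hη)
    refine ⟨N, fun q hq t ht x => ((hIE q).stress_le t ht x).trans ?_⟩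
    calc BDSV.amp β a b (q + 1) * BDSV.freq a b q ^ (-3 * γ)
        ≤ BDSV.amp β a b (q + 1) * 1 := by
          gcongr
          · exact (hδ_pos _).le
          · rw [neg_mul]
            exact BDSV.freq_rpow_neg_le_one ha1.le (by positivity) q
      _ ≤ η := by rw [mul_one]; exact hN q hq
  /- Step 6: uniform `C^{β'}_x` bounds: `[v_q(t)]_{β'} ≤ ∑_k K λ_{k+1}^{β'-β} =: H`. -/
  obtain ⟨K, hKdef⟩ : ∃ K : ℝ, K = (2 * M) ^ (1 - (β' : ℝ)) * (6 * M) ^ (β' : ℝ) := ⟨_, rfl⟩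
  have hK : 0 ≤ K := by rw [hKdef]; positivity
  have hhol_sum : Summable fun q : ℕ => K * BDSV.freq a b (q + 1) ^ (-(β - β')) :=
    (BDSV.summable_freq_succ_rpow_neg ha1 hb1 (sub_pos.2 hβ'β)).mul_left K
  have hhol_nn : ∀ q, 0 ≤ K * BDSV.freq a b (q + 1) ^ (-(β - β')) := fun q =>
    mul_nonneg hK (Real.rpow_nonneg (hlam_pos _).le _)
  have hholv : ∀ q, ∀ t ∈ Icc 0 (c * T), ∀ x y, ‖(Z q).1 t x - (Z q).1 t y‖ ≤
      (∑ k ∈ Finset.range q, K * BDSV.freq a b (k + 1) ^ (-(β - β'))) * dist x y ^ (β' : ℝ) := by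
    intro q
    induction q with
    | zero =>
        intro t ht x y
        simp [hZ0]
    | succ q ih =>
        intro t ht x y
        have hw := BDSV.norm_increment_sub_le (hER q) (hER (q + 1)) (hVI q) hT'.le ha1.le hM.le
          hβ'0 hβ'1 ht x y
        rw [← hKdef, show ((β' : ℝ) - β) = -(β - β') by ring] at hw
        calc ‖(Z (q + 1)).1 t x - (Z (q + 1)).1 t y‖
            = ‖((Z q).1 t x - (Z q).1 t y) +
                (((Z (q + 1)).1 t x - (Z q).1 t x) - ((Z (q + 1)).1 t y - (Z q).1 t y))‖ := by
              congr 1; abel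
          _ ≤ ‖(Z q).1 t x - (Z q).1 t y‖ +
                ‖((Z (q + 1)).1 t x - (Z q).1 t x) - ((Z (q + 1)).1 t y - (Z q).1 t y)‖ :=
              norm_add_le _ _
          _ ≤ (∑ k ∈ Finset.range q, K * BDSV.freq a b (k + 1) ^ (-(β - β'))) *
                  dist x y ^ (β' : ℝ) +
                K * BDSV.freq a b (q + 1) ^ (-(β - β')) * dist x y ^ (β' : ℝ) :=
              add_le_add (ih t ht x y) hw
          _ = (∑ k ∈ Finset.range (q + 1), K * BDSV.freq a b (k + 1) ^ (-(β - β'))) *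
                dist x y ^ (β' : ℝ) := by
              rw [Finset.sum_range_succ]; ring
  obtain ⟨H, hHdef⟩ : ∃ H : ℝ, H = ∑' k, K * BDSV.freq a b (k + 1) ^ (-(β - β')) := ⟨_, rfl⟩
  have hH0 : 0 ≤ H := by rw [hHdef]; exact tsum_nonneg hhol_nn
  have hsumH : ∀ q, ∑ k ∈ Finset.range q, K * BDSV.freq a b (k + 1) ^ (-(β - β')) ≤ H :=
    fun q => by rw [hHdef]; exact hhol_sum.sum_le_tsum _ (fun k _ => hhol_nn k)
  /- Step 7: undo the scaling: `v_q(t) = c ṽ_q(ct)`, `u(t) = c ũ(ct)` on `[0,T] = [0, T'/c]`. -/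
  have hTc : c * T / c = T := by field_simp
  have hct : ∀ t ∈ Icc 0 T, c * t ∈ Icc 0 (c * T) := fun t ht =>
    ⟨mul_nonneg hc.le ht.1, mul_le_mul_of_nonneg_left ht.2 hc.le⟩
  have hERv : ∀ q, Torus.IsEulerReynoldsOn (Icc 0 T) (fun t x => c • (Z q).1 (c * t) x)
      (fun t x => c ^ 2 * (Z q).2.1 (c * t) x) (fun t x => c ^ 2 • (Z q).2.2 (c * t) x) := by
    intro q
    have := (hER q).timeRescale hT' hc
    rwa [hTc] at this
  have hconv : ∀ η > 0, ∃ N : ℕ, ∀ q ≥ N, ∀ t ∈ Icc 0 T, ∀ x,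
      ‖(fun t x => c • (Z q).1 (c * t) x) t x - (fun t x => c • ũ (c * t) x) t x‖ ≤ η := by
    intro η hη
    obtain ⟨N, hN⟩ := hconvT' (η / c) (div_pos hη hc)
    refine ⟨N, fun q hq t ht x => ?_⟩
    rw [← smul_sub, norm_smul, Real.norm_eq_abs, abs_of_pos hc]
    calc c * ‖(Z q).1 (c * t) x - ũ (c * t) x‖ ≤ c * (η / c) := by
          gcongr
          exact hN q hq _ (hct t ht) x
      _ = η := by field_simp
  have hstress : ∀ η > 0, ∃ N : ℕ, ∀ q ≥ N, ∀ t ∈ Icc 0 T, ∀ x,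
      ‖(fun t x => c ^ 2 • (Z q).2.2 (c * t) x) t x‖ ≤ η := by
    intro η hη
    obtain ⟨N, hN⟩ := hstressT' (η / c ^ 2) (div_pos hη (by positivity))
    refine ⟨N, fun q hq t ht x => ?_⟩
    rw [norm_smul, Real.norm_eq_abs, abs_of_pos (by positivity : (0 : ℝ) < c ^ 2)]
    calc c ^ 2 * ‖(Z q).2.2 (c * t) x‖ ≤ c ^ 2 * (η / c ^ 2) := by
          gcongr
          exact hN q hq _ (hct t ht) x
      _ = η := by field_simp
  have hHol : ∃ C : ℝ≥0, ∀ q, ∀ t ∈ Icc 0 T,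
      HolderWith C β' ((fun t x => c • (Z q).1 (c * t) x) t) := by
    refine ⟨Real.toNNReal (c * H), fun q t ht =>
      BDSV.holderWith_of_norm_sub_le (by positivity) fun x y => ?_⟩
    rw [← smul_sub, norm_smul, Real.norm_eq_abs, abs_of_pos hc, mul_assoc]
    refine mul_le_mul_of_nonneg_left ?_ hc.le
    calc ‖(Z q).1 (c * t) x - (Z q).1 (c * t) y‖
        ≤ (∑ k ∈ Finset.range q, K * BDSV.freq a b (k + 1) ^ (-(β - β'))) *
            dist x y ^ (β' : ℝ) := hholv q _ (hct t ht) x y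
      _ ≤ H * dist x y ^ (β' : ℝ) := by
          gcongr
          exact hsumH q
  /- Step 8: the energy identity at the limit, `∫ |ũ(s)|² = κ e(s/c)` on `[0, cT]`. -/
  have hcontũ : ContinuousOn (FunctionSpaces.Torus.stLift ũ) (Icc 0 (c * T) ×ˢ univ) :=
    Torus.continuousOn_stLift_of_unifLimit
      (fun q => (hER q).smooth_velocity.continuousOn_stLift) hconvT'
  have hEn : ∀ s ∈ Icc 0 (c * T), ∫ x, ‖ũ s x‖ ^ 2 = κ * e (c⁻¹ * s) := fun s hs =>
    BDSV.integral_norm_sq_eq_of_unifLimit (S := Icc 0 (c * T)) (w := fun q => (Z q).1)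
      (e := fun s => κ * e (c⁻¹ * s)) (ρ := fun q => BDSV.amp β a b (q + 1)) (τ := tail)
      (fun q s hs => ((hER q).smooth_velocity.isSmooth_slice hs).continuous)
      (fun s hs => FunctionSpaces.Torus.continuous_slice_of_continuousOn_stLift hcontũ hs)
      (fun q s hs x => ((hIE q).velocity_le s hs x).trans
        (by linarith [Real.sqrt_nonneg (BDSV.amp β a b q)]))
      hũ' htail_nn htail
      (fun q s hs => by
        rw [abs_le]
        constructor
        · have hge := (hIE q).energy_ge s hs
          have hnn : 0 ≤ BDSV.amp β a b (q + 1) * BDSV.freq a b q ^ (-γ) :=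
            mul_nonneg (hδ_pos _).le (Real.rpow_nonneg (hlam_pos q).le _)
          linarith [(hδ_pos (q + 1)).le]
        · exact (hIE q).energy_le s hs)
      hδ_tend hs
  /- Step 9: conclusion. -/
  refine ⟨fun t x => c • ũ (c * t) x,
    Torus.isWeakEulerSolutionOn_of_unifLimit hT hERv hconv hstress,
    htime T hT β' hβ'pos hβ'lt _ _ _ _ hERv hconv hstress hHol α hαβ', fun t ht => ?_⟩
  show 2⁻¹ * ∫ x, ‖c • ũ (c * t) x‖ ^ 2 = e t
  have hsq : ∀ x, ‖c • ũ (c * t) x‖ ^ 2 = c ^ 2 * ‖ũ (c * t) x‖ ^ 2 := fun x => by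
    rw [norm_smul, Real.norm_eq_abs, abs_of_pos hc, mul_pow]
  simp_rw [hsq, integral_const_mul]
  rw [hEn _ (hct t ht), show c⁻¹ * (c * t) = t by field_simp, ← mul_assoc (c ^ 2), hκc]
  ring

/-- **Dissipative Hölder-continuous Euler flows from the BDSV scheme** (Buckmaster–De Lellis–
Székelyhidi–Vicol 2019, Thm. 1.1 with a strictly decreasing profile; Isett, Ann. Math. 188
(2018), Thm. 1): Prop. 2.1 and the time-regularity step imply the dissipative form
`onsager_flexibility_strictAntiOn` (via `onsager_flexibility_strictAntiOn_of`).
[cite: BuckmasterEtAl2018, Thm. 1.1] -/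
theorem onsager_flexibility_strictAntiOn_of_bdsv (hmain : BDSV.mainIteration)
    (htime : BDSV.timeRegularity) : onsager_flexibility_strictAntiOn :=
  onsager_flexibility_strictAntiOn_of (onsager_flexibility_of_bdsv hmain htime)

end Assembly

end Literature.Analysis.FluidPDE
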